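import Literature.AlgebraicGeometry.HodgeTheory.QuaternionicQuarticGenericModelOfCJS
import Summits.HodgeConjecture.HodgeConjecture.Theorems.Q8SymplecticPowersFamilyDeckOfGenericModel
import HarnessLib

/-!
# K1Q line `mechanism-v2`: the S6 deck-family ∃-package FROM THE CJS CANONICAL RESOLUTION OF SURFACES (Kollár-free re-keying)

Route `HodgeConjecture/Q8SymplecticPowers`, crux K1Q `VeryGeneralQuaternionCommutatorsInHg` (stmt-HodgeConjecture-24190). Helper
(`--supports … --as helper`; nothing here closes an item). The registered S6 stub reads `Kollar2007_resolutionLiftsAutomorphisms → <package>`;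
this file proves `CossartJannsenSaito2020SequenceFunctorial → <package>` (consequent VERBATIM): the deck family — the family half of
the local-certificate stubs LCERT₄ ∕ LCERT_{≥6} — needs only the canonical resolution of excellent SURFACES with its Zariski-localisation
functoriality (Cossart–Jannsen–Saito 2020, Thm. 1.2; named fact in the tree), not Kollár's all-dimension functorial resolution.
Composition: `Q8Family.exists_genericModel_of_CJS` (this seat) then `stub_familyDeckExistsQ_of_genericModel`.

Honest scope: conditional on the CJS named fact; S6's registered form, LCERT, K1Q and HC are NOT proved here.
-/

set_option linter.dupNamespace false

open CategoryTheory AlgebraicGeometry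

namespace Summit.HodgeConjecture.HodgeConjecture.Theorems.Q8SymplecticPowersFamilyDeckOfCJS

/-- **The S6 deck-family ∃-package from the Cossart–Jannsen–Saito canonical resolution of surfaces** (consequent = the
registered stub `stub_familyDeckExistsQ` minus its Kollár binder, verbatim). [cite: CossartJannsenSaito2020, Thm. 1.2 (p. 5)]
[cite: Kollar2007, Thm. 3.36 and §3.4.1] [cite: EGAIV3, Thm. 8.10.5] -/
theorem stub_familyDeckExistsQ_of_CJS
    (hCJS : Literature.AlgebraicGeometry.Resolution.CossartJannsenSaito2020SequenceFunctorial.{0}) :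
    open Literature.AlgebraicGeometry.Motives Literature.AlgebraicGeometry.HodgeTheory Literature.AlgebraicGeometry.HodgeTheory.BettiUniverse Literature.AlgebraicGeometry.HodgeTheory.Q8Family Literature.AlgebraicGeometry.RelativeSpec Literature.AlgebraicGeometry.RelativeSpec.ActionOver Literature.Algebra.Lie Literature.Algebra.Lie.KatzRecognition CategoryTheory CategoryTheory.Limits MonoidalCategory CartesianMonoidalCategory AlgebraicGeometry in ∀ ⦃e : ℕ⦄, Even e → 4 ≤ e → ∃ (W : (Spec (.of (ParamRing e))).Opens) (𝒳 : SchemeOver ℂ) (π : 𝒳 ⟶ base W) (τ j : 𝒳 ⟶ 𝒳) (ι : (deckChart (fun i => (MvPolynomial.X i : ParamRing e)) ⊗ Over.mk W.ι).left ⟶ 𝒳.left), Nonempty (ComplexPoints (base W)) ∧ IsSmoothProjectiveFamily π 2 ∧ IsQuasiProjectiveOver 𝒳 ∧ IsQuasiProjectiveOver (base W) ∧ AlgebraicGeometry.SmoothOfRelativeDimension (Fintype.card (CIdx e)) (base W).hom ∧ (τ ≫ π = π ∧ j ≫ π = π ∧ τ ≫ τ ≫ τ ≫ τ = 𝟙 𝒳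 ∧ j ≫ j = τ ≫ τ ∧ τ ≫ j ≫ τ = j) ∧ IsOpenImmersion ι ∧ ι ≫ π.left = (snd (deckChart (fun i => (MvPolynomial.X i : ParamRing e))) (Over.mk W.ι)).left ∧ ((Over.isoMk ((deckAction (fun i => (MvPolynomial.X i : ParamRing e))).aut (QuaternionGroup.a 1)) ((deckAction (fun i => (MvPolynomial.X i : ParamRing e))).aut_comp (QuaternionGroup.a 1))).hom ▷ Over.mk W.ι).left ≫ ι = ι ≫ τ.left ∧ ((Over.isoMk ((deckAction (fun i => (MvPolynomial.X i : ParamRing e))).aut (QuaternionGroup.xa 0)) ((deckAction (fun i => (MvPolynomial.X i : ParamRing e))).aut_comp (QuaternionGroup.xa 0))).hom ▷ Over.mk W.ι).left ≫ ι = ι ≫ j.left ∧ Function.Surjective (snd (deckChart (fun i => (MvPolynomial.X i : ParamRing e))) (Over.mk W.ι)).left :=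
  Q8SymplecticPowersFamilyDeckOfGenericModel.stub_familyDeckExistsQ_of_genericModel fun e he =>
    Literature.AlgebraicGeometry.HodgeTheory.Q8Family.exists_genericModel_of_CJS hCJS e he

end Summit.HodgeConjecture.HodgeConjecture.Theorems.Q8SymplecticPowersFamilyDeckOfCJS
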